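import Summits.BirchSwinnertonDyer.Rank1Residual.X11b.CastellaErratum
import Summits.BirchSwinnertonDyer.Rank1Residual.X11b.BDPRoute
import HarnessLib

/-!
# X11b — the two research routes' populations compared: `ChainLocus` (R1) vs `Locus` (BDP route)

HONEST FRAMING (cell `b2b-bsdres`, run/shared/lean/b2b/bsd-rank1-residual/, verbatim in every
file): the goal of the cell is to DELETE the COMBINATION-SHAPED residual classes of the
Birch–Swinnerton-Dyer formula for ALL analytic-rank `≤ 1` elliptic curves over `ℚ` — "full BSD
formula for every rank `≤ 1` curve in class `C`" assembled STRICTLY from published theorems — so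
that the rank-`≤ 1` remainder becomes exactly the CONSTRUCTION-SHAPED classes, which are TYPED
(missing-input `Prop`s), NOT attempted. This is not "finishing BSD". Sub-cell
`b2b-bsdres-multr1-p1` (X11b via the re-proof of Castella 2018 Thm. A along the author's erratum):
a RESEARCH ROUTE; no claim beyond the stated class; X11b stays CONSTRUCTION-SHAPED; nothing here
changes a label. THEOREMS ONLY (bookkeeping between two existing predicates; no `sorry`).

The human's brief for the two X11b sub-cells: "state exactly which `(E, p)` in X11b each route
settles". The kernel predicates are `ChainLocus W p` (route R1 = `multr1-p1`, file
`CastellaErratum.lean`: `5 ≤ p ∧ mult(p) ∧ irr(p) ∧ X11.AprimeRam2LocusAt W p`, i.e. a NONSPLIT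
multiplicative `q ≠ p` and a further multiplicative `ℓ ∉ {p, q}` with `E[p]` ramified at both, and
`E(ℚ_p)[p] = 0`) and `Locus W p` (BDP route = `multr1-p2`, file `BDPRoute.lean`:
`5 ≤ p ∧ Ram W p ∧ ¬ p ∣ ∏_ℓ c_ℓ(E)`), each settling its population CONDITIONALLY on the same
unrefereed atom (Fouquet–Wan arXiv:2107.13726 Thm. 4.41, through Castella's erratum). This file
records their formal relation: `ChainLocus ⇒ Ram` (`ChainLocus.ram`), so the two populations
coincide on `p ∤ ∏ c_ℓ` from the R1 side (`ChainLocus.locus_of_not_dvd_tamagawaProduct`) and the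
R1-only pairs are exactly the `ChainLocus` pairs with `p ∣ ∏ c_ℓ`
(`ChainLocus.dvd_tamagawaProduct_of_not_locus`); the `Locus`-only pairs are those with no NONSPLIT
ramified `q`, or with only one ramified multiplicative prime, or with `E(ℚ_p)[p] ≠ 0`.

CENSUS (data, not a claim; this sub-cell's gen-4 jobs j085024/j085026/j085029/j085030, engine cypari2,
cross-checked against the gp engine of j077241/j084901 on 141 + 69 pairs with 0 mismatches; files
`run/shared/lean/b2b/bsd-rank1-residual/b2b-bsdres-multr1-p1/census500k/`). Population = ALL Cremona
isogeny classes of rank `1` with `N < 5·10⁵` (curve #1), primes `p ≥ 5` with `p ∥ N` and `E[p]`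
irreducible — the whole X11b shape at `p ≥ 5`, NOT the lane's residue (most of these pairs are
closed per pair by index certificates): 2 267 348 pairs, of which `ChainLocus` 1 357 341 (59.9 %),
A′-hypotheses 1 603 386, `Locus` 2 093 111 (92.3 %), `ChainLocus ∪ Locus` 2 128 026 (93.9 %),
`ChainLocus ∩ Locus` 1 322 426, neither 139 322 (6.1 %); window `N < 2·10⁴`: 70 420 pairs,
`ChainLocus` 33 515, `Locus` 61 629, union 62 593, neither 7 827; on x11a's 141 residue + T-CAS pairs
(`N < 2·10⁴`): `ChainLocus` 46, `Locus` 49 (= gen 1 / multr1-p2's counts). `ChainLocus` fails for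
lack of a NONSPLIT ramified `q` (660 191 + 1 018 pairs), of a second ramified multiplicative prime
(246 045), or because `E(ℚ_p)[p] ≠ 0` (2 753 + 1 018).

References: F. Castella, Erratum, Thm. A′ [Castella2018Erratum]; Camb. J. Math. 6 (2018) §5
[Castella2018]; Jetchev–Skinner–Wan, Camb. J. Math. 5 (2017) §7.4.2 (choice of the field)
[JetchevSkinnerWan2017].
-/

noncomputable section

open scoped Classical

open WeierstrassCurve Literature.NumberTheory.EllipticCurves
  Literature.NumberTheory.EllipticCurves.Rank1Residual

namespace Summit.BirchSwinnertonDyer.Rank1Residual.X11b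

variable {W : WeierstrassCurve ℚ} [W.IsGloballyMinimal] {p : ℕ} [Fact p.Prime]

/-- A pair on route R1's population has a multiplicative prime `ℓ ≠ p` at which `E[p]` is ramified
(`Ram`; either of the two primes of `AprimeRam2LocusAt` will do). [folklore] -/
theorem ChainLocus.ram (h : ChainLocus W p) : Ram W p := by
  obtain ⟨⟨q, hq, ℓ, hℓ, hqp, hℓp, -, hqm, -, hqv, -, -⟩, -⟩ := h.2.2.2
  exact ⟨q, hq, hqp, hqm, hqv⟩

/-- **The two routes' populations meet exactly on `p ∤ ∏ c_ℓ`**: a pair on R1's `ChainLocus` with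
`p ∤ ∏_ℓ c_ℓ(E)` is on the BDP route's `Locus` (`5 ≤ p ∧ Ram ∧ p ∤ ∏ c_ℓ`). [folklore] -/
theorem ChainLocus.locus_of_not_dvd_tamagawaProduct (h : ChainLocus W p)
    (htam : ¬ p ∣ W.tamagawaProduct) : Locus W p :=
  ⟨h.1, h.ram, htam⟩

/-- Conversely, off `Locus` a `ChainLocus` pair has `p ∣ ∏_ℓ c_ℓ(E)` (the pairs reached by R1 only).
[folklore] -/
theorem ChainLocus.dvd_tamagawaProduct_of_not_locus (h : ChainLocus W p) (hL : ¬ Locus W p) :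
    p ∣ W.tamagawaProduct := by
  by_contra htam
  exact hL (h.locus_of_not_dvd_tamagawaProduct htam)

end Summit.BirchSwinnertonDyer.Rank1Residual.X11b

end
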